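import Literature.MathematicalPhysics.QuantumFieldTheory.Balaban1983to89.B1Eq324BenfattoConnLength
import HarnessLib

/-!
# `Balaban1983to89.B1Eq324BenfattoTranslation` — [BenfattoEtAl1978] §5 p. 159 «choosing a new pavement Q′_b displaced by b²/2 … we can proceed
# as before»: TRANSLATION INVARIANCE of the free field (1.1) and of the decay length `d(Δ₁…Δ_p)`, PROVED for the tree's objects — the transport
# that carries every statement about the pavement at shift `0` to a displaced pavement

statement-level skeleton of published theorems with citation tags; proofs where landed; nothing here is a claim about the
Yang–Mills mass gap

WHY THIS MODULE (cell `pub-ymgap`, seat `dag-n08-d` gen 8, INTENT-23; node N08 [Balaban1985UV3]; the [BenfattoEtAl1978] source chain behind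
the (α)-row `h324c`).  §5's proof of the Basic Lemma iterates the corridor construction over `d + 1` DISPLACED pavements (p. 159: *"we can
proceed as before choosing a new pavement Q′_b displaced by b²/2 with respect to Q_b … Again one proceeds as before by choosing a third
pavement Q″_b displaced by b²/4 …"*; termination: `B1Eq324BenfattoSect5Pavements.not_forall_inCorridor`).  «As before» rests on the
translation invariance of the free field `P̂₀` (its covariance `β⁻¹C¹_{α²}(x − y)` depends on `x − y` only) and of the decay length
`d(Δ₁…Δ_p)`; this file proves both for the tree's objects, so the box/corridor theorems of `Sect5Boxes`, `Sect5Eq511`, `Sect5Eq524` (stated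
for the pavement with corner lattice `Lℤ^d`) transport to any shifted pavement.

WHAT IS HERE (no definition, no `sorry`; axioms standard): `freeCov_add_right`; `cubeDist_add_right`; `unitCube_add_iff`, `segLength_add_right`,
`polyLength_add_right`, ★ `connLength_add_right` (`d(Δ + s) = d(Δ)`); ★★ `P0_map_translate` (`(P0 d α β).map (fun z x => z (x + s)) = P0 d α β`,
Gaussian uniqueness); ★ `integral_P0_comp_translate` (`∫ F(z ∘ (· + s)) dP̂₀ = ∫ F dP̂₀`); `mem_smallFieldSet_translate_iff` (the cut-off set
«Π_Δ χ̂_Δ» shifts with `I`: `z ∘ (· + s) ∈ smallFieldSet I b ↔ z ∈ smallFieldSet (I + s) b`).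
HONEST SCOPE.  Transport lemmas only; count-neutral for N08; `BasicLemmaPrinted` NOT discharged; nothing about d = 4, the continuum, OS axioms,
a mass gap or the Clay problem.
-/

noncomputable section

open Finset
open scoped BigOperators

namespace Literature.MathematicalPhysics.QuantumFieldTheory.Balaban1983to89.B1Eq324BenfattoTranslation

open _root_.MeasureTheory _root_.ProbabilityTheory
open Literature.MathematicalPhysics.QuantumFieldTheory
open Literature.MathematicalPhysics.QuantumFieldTheory.Balaban1983to89.B1Eq324BenfattoLemma
open Literature.MathematicalPhysics.QuantumFieldTheory.Balaban1983to89.B1Eq324BenfattoConnLength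

variable {d : ℕ}

/-! ## §1  The covariance, the cube distance and the decay length are translation invariant -/

/-- **`K(x + s, y + s) = K(x, y)`** — the covariance of (1.1) depends on `x − y` only. [cite: BenfattoEtAl1978, (1.1) p.144] -/
theorem freeCov_add_right (α β : ℝ) (x y s : B1Eq324BenfattoLemma.Site d) :
    freeCov d α β (x + s) (y + s) = freeCov d α β x y := by
  simp only [freeCov, add_sub_add_right_eq_sub]

/-- `cubeDist (x + s) (y + s) = cubeDist x y`. [cite: BenfattoEtAl1978, after (2.3) p.146] -/
theorem cubeDist_add_right (x y s : B1Eq324BenfattoLemma.Site d) : cubeDist (x + s) (y + s) = cubeDist x y := by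
  simp only [cubeDist, Pi.add_apply, Int.cast_add, add_sub_add_right_eq_sub]

/-- `u ∈ Δ_{x+s} ↔ u − s ∈ Δ_x`. [cite: BenfattoEtAl1978, §1 p.144] -/
theorem unitCube_add_iff (x s : B1Eq324BenfattoLemma.Site d) (u : Fin d → ℝ) :
    u ∈ unitCube (x + s) ↔ (fun j => u j - (s j : ℝ)) ∈ unitCube x := by
  simp only [unitCube, Set.mem_setOf_eq, Pi.add_apply, Int.cast_add]
  refine forall_congr' fun j => ?_
  constructor <;> rintro ⟨h1, h2⟩ <;> constructor <;> linarith

/-- `segLength` is translation invariant. [cite: BenfattoEtAl1978, after (4.1) p.151] -/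
theorem segLength_add_right (u v c : Fin d → ℝ) : segLength (fun j => u j + c j) (fun j => v j + c j) = segLength u v := by
  simp only [segLength, add_sub_add_right_eq_sub]

/-- `polyLength` is translation invariant. [cite: BenfattoEtAl1978, after (4.1) p.151] -/
theorem polyLength_add_right : ∀ {p : ℕ} (y : Fin p → (Fin d → ℝ)) (c : Fin d → ℝ),
    polyLength (fun i j => y i j + c j) = polyLength y
  | 0, y, c => by rw [polyLength_zero', polyLength_zero']
  | 1, y, c => by rw [polyLength_one', polyLength_one']
  | p + 2, y, c => by
      rw [polyLength_succ_succ, polyLength_succ_succ, segLength_add_right]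
      congr 1
      exact polyLength_add_right (fun i : Fin (p + 1) => y i.succ) c

/-- **`d(Δ₁ + s, …, Δ_p + s) = d(Δ₁, …, Δ_p)`** — the decay length is translation invariant (a connecting polygon translates with the
cubes). [cite: BenfattoEtAl1978, after (4.1) p.151; p.159] -/
theorem connLength_add_right {p : ℕ} (Δ : Fin p → B1Eq324BenfattoLemma.Site d) (s : B1Eq324BenfattoLemma.Site d) :
    connLength (fun i => Δ i + s) = connLength Δ := by
  unfold connLength
  congr 1
  ext ℓ
  simp only [Set.mem_setOf_eq]
  constructor
  · rintro ⟨σ, y, hy, rfl⟩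
    refine ⟨σ, fun i j => y i j - (s j : ℝ), fun i => (unitCube_add_iff _ _ _).mp (hy i), ?_⟩
    have h := polyLength_add_right (fun i j => y i j - (s j : ℝ)) (fun j => (s j : ℝ))
    simp only [sub_add_cancel] at h
    exact h
  · rintro ⟨σ, y, hy, rfl⟩
    refine ⟨σ, fun i j => y i j + (s j : ℝ), fun i => (unitCube_add_iff _ _ _).mpr (by simpa using hy i), ?_⟩
    exact (polyLength_add_right y fun j => (s j : ℝ)).symm

/-! ## §2  The free field `P̂₀` is translation invariant -/

section Field

variable {α β : ℝ}

/-- kernel: the translation of configurations `z ↦ z ∘ (· + s)` is measurable. [folklore] -/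
private theorem measurable_translate (s : B1Eq324BenfattoLemma.Site d) :
    Measurable fun (z : B1Eq324BenfattoLemma.Site d → ℝ) (x : B1Eq324BenfattoLemma.Site d) => z (x + s) :=
  measurable_pi_lambda _ fun x => measurable_pi_apply (x + s)

/-- **P̂₀ IS TRANSLATION INVARIANT**: the law of `(z_{Δ + s})_Δ` under `P̂₀` is `P̂₀` — the image is a centred Gaussian law on the
configurations with covariance `K(x + s, y + s) = K(x, y)`, hence equals `P̂₀` by uniqueness (`eq_gaussianFieldOfKernel_of_isGaussianProcess`).
This is the «we can proceed as before» of the displaced pavements, p. 159. [cite: BenfattoEtAl1978, (1.1) p.144; §5 p.159] -/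
theorem P0_map_translate (hα : 0 < α) (hβ : 0 < β) (s : B1Eq324BenfattoLemma.Site d) :
    (P0 d α β).map (fun (z : B1Eq324BenfattoLemma.Site d → ℝ) (x : B1Eq324BenfattoLemma.Site d) => z (x + s)) = P0 d α β := by
  have hK := isPosSemidefKernel_freeCov (d := d) hα hβ
  haveI : IsProbabilityMeasure (P0 d α β) := isProbabilityMeasure_P0 hα hβ
  have hTm := measurable_translate (d := d) s
  haveI : IsProbabilityMeasure ((P0 d α β).map fun (z : B1Eq324BenfattoLemma.Site d → ℝ) (x : B1Eq324BenfattoLemma.Site d) => z (x + s)) :=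
    Measure.isProbabilityMeasure_map hTm.aemeasurable
  -- (i) the coordinate process of the image is Gaussian: it is the original process re-indexed by `· + s`
  have hG : IsGaussianProcess (fun (x : B1Eq324BenfattoLemma.Site d) (z : B1Eq324BenfattoLemma.Site d → ℝ) => z x)
      ((P0 d α β).map fun (z : B1Eq324BenfattoLemma.Site d → ℝ) (x : B1Eq324BenfattoLemma.Site d) => z (x + s)) := by
    refine ⟨fun I => ⟨?_⟩⟩
    have hrm : Measurable (fun z : B1Eq324BenfattoLemma.Site d → ℝ => I.restrict z) := Finset.measurable_restrict I
    rw [Measure.map_map hrm hTm]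
    have h := ((isGaussianProcess_P0 hα hβ).comp_right (fun x : B1Eq324BenfattoLemma.Site d => x + s)).hasGaussianLaw I
    exact h.isGaussian_map
  -- (ii) mean zero, (iii) covariance `K`
  have hm : ∀ x, ∫ z, z x ∂(P0 d α β).map (fun (z : B1Eq324BenfattoLemma.Site d → ℝ) (x : B1Eq324BenfattoLemma.Site d) => z (x + s)) = 0 := by
    intro x
    rw [integral_map hTm.aemeasurable (measurable_pi_apply x).aestronglyMeasurable]
    exact integral_eval_P0 hα hβ (x + s)
  have hc : ∀ x y, cov[fun z : B1Eq324BenfattoLemma.Site d → ℝ => z x, fun z => z y;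
      (P0 d α β).map (fun (z : B1Eq324BenfattoLemma.Site d → ℝ) (x : B1Eq324BenfattoLemma.Site d) => z (x + s))] = freeCov d α β x y := by
    intro x y
    rw [covariance_map (measurable_pi_apply x).aestronglyMeasurable (measurable_pi_apply y).aestronglyMeasurable hTm.aemeasurable]
    change cov[fun z : B1Eq324BenfattoLemma.Site d → ℝ => z (x + s), fun z => z (y + s); P0 d α β] = _
    rw [covariance_eval_P0 hα hβ, freeCov_add_right]
  exact eq_gaussianFieldOfKernel_of_isGaussianProcess hK hG hm hc

/-- **Integrals against P̂₀ are translation invariant**: `∫ F(z ∘ (· + s)) dP̂₀(z) = ∫ F dP̂₀` for measurable `F`.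
[cite: BenfattoEtAl1978, (1.1) p.144; §5 p.159] -/
theorem integral_P0_comp_translate (hα : 0 < α) (hβ : 0 < β) (s : B1Eq324BenfattoLemma.Site d)
    {F : (B1Eq324BenfattoLemma.Site d → ℝ) → ℝ} (hF : Measurable F) :
    ∫ z, F (fun x => z (x + s)) ∂P0 d α β = ∫ z, F z ∂P0 d α β := by
  have hTm := measurable_translate (d := d) s
  rw [← integral_map hTm.aemeasurable hF.aestronglyMeasurable, P0_map_translate hα hβ s]

end Field

/-! ## §3  The cut-off set shifts with the region -/

/-- **The small-field set «Π_Δ χ̂_Δ» shifts with `I`**: `z ∘ (· + s) ∈ smallFieldSet I b ↔ z ∈ smallFieldSet (I + s) b`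
(`d(I + s, Δ_{x+s}) = d(I, Δ_x)`). [cite: BenfattoEtAl1978, p.152; (A.1) p.161] -/
theorem mem_smallFieldSet_translate_iff (I : Finset (B1Eq324BenfattoLemma.Site d)) (b : ℝ) (s : B1Eq324BenfattoLemma.Site d)
    (z : B1Eq324BenfattoLemma.Site d → ℝ) :
    (fun x => z (x + s)) ∈ smallFieldSet I b ↔ z ∈ smallFieldSet (I.image fun x => x + s) b := by
  have hdist : ∀ x, distToRegion (I.image fun x => x + s) (x + s) = distToRegion I x := by
    intro x
    by_cases hI : I.Nonempty
    · have hI' : (I.image fun x => x + s).Nonempty := hI.image _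
      rw [distToRegion, dif_pos hI', distToRegion, dif_pos hI, Finset.inf'_image]
      congr 1
      funext y
      simp only [Function.comp_apply, cubeDist_add_right]
    · have hI' : ¬ (I.image fun x => x + s).Nonempty := by
        rwa [Finset.image_nonempty]
      rw [distToRegion, dif_neg hI', distToRegion, dif_neg hI]
  simp only [smallFieldSet, Set.mem_setOf_eq]
  constructor
  · intro h x
    have h' := h (x - s)
    rw [sub_add_cancel] at h'
    rw [← hdist (x - s), sub_add_cancel] at h'
    exact h'
  · intro h x
    rw [← hdist x]
    exact h (x + s)

end Literature.MathematicalPhysics.QuantumFieldTheory.Balaban1983to89.B1Eq324BenfattoTranslation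

end
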